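import Summits.CriticalPhenomena.PercolationContinuityZ3.Theorems.PercNearOneGluingNoHeavyLowerTailIncStarTwoCutFarPatterns
import Summits.CriticalPhenomena.PercolationContinuityZ3.Theorems.PercNearOneGluingNoHeavyLowerTailIncStarTwoCutFXSemantics
import HarnessLib

/-!
# MODE B, XXI: the (FX)/(FY) forms as STRUCTURED kernel expressions and their values

Support file for the Sahi programme (`--supports stmt-CriticalPhenomena-4575`, prover prim-sahi-p2 gen 28).  No sorries, no named facts,
no `native_decide`.  The certificate targets `fxTargetPos/Neg`, `fyTargetPos/Neg` (gen 27) are the 7184 monomials of `D·FX_hom`, `D·FY_hom`,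
where `FX_hom` is the bihomogeneous `(3,3)` form of gen 27's `bipoly.fx_bipoly`: the moved-target star `M_u` in the reduced form (R1)
(`IncStarTwoCut.twoCut_sahiE3_rootSide_eq` at `t = u`: `M_u = Φ_X qX + Φ_XY qW + Φ_D qY`) minus `π_xy·σ_u`, written in the 15 far cells
(outside numbers `bx = m(x~b)`, …, `ζ = m(x~y)` as mask sums) and the near class variables, every term padded to bidegree `(3,3)` by the factors
`S_q = q0+qX+qY+qW` and `S_f = Σ cells` (both `= 1` on a law).  This file writes that form STRUCTURALLY as a `Lean.Grind.CommRing.Expr`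
(`fxFormE`, `fyFormE`) together with the real-valued function it denotes (`fxFormVal`, `fyFormVal`; `denote_fxFormE`), and evaluates the
latter on a law (`fxFormVal_eq`, `fyFormVal_eq`: with `S_q = S_f = 1` it is `M_u − π_xy σ_u` in the vocabulary of `…IncStarTwoCutGlueFX`).
The identification `D·fxFormE ≡ ftargetE fxTargetPos fxTargetNeg` (normal forms) is the computational file `…IncStarTwoCutFXFormCheck`.
Far masks (labels `0=x(=u), 1=y(=v), 2=b, 3=c`): `mBX = {x~b}`, `mBY = {y~b}`, `mCX = {x~c}`, `mCY = {y~c}`, `mZ = {x~y}` and their lattice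
combinations.
-/

namespace Summit.CriticalPhenomena.PercolationContinuityZ3.Theorems

namespace IncStarTwoCut.FXCert

open Lean.Grind.CommRing FourPointCert IncStarTwoCut.FarCert

/-! ### Far masks -/

/-- `{x ~ b}`. [this work] -/
def mBX : ℕ := fconnMask 0 2
/-- `{y ~ b}`. [this work] -/
def mBY : ℕ := fconnMask 1 2
/-- `{x ~ c}`. [this work] -/
def mCX : ℕ := fconnMask 0 3
/-- `{y ~ c}`. [this work] -/
def mCY : ℕ := fconnMask 1 3
/-- `{x ~ y}`. [this work] -/
def mZ : ℕ := fconnMask 0 1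
/-- `{x~b} ∪ {y~b}`. [this work] -/
def mBU : ℕ := mBX ||| mBY
/-- `{x~b} ∩ {y~b}`. [this work] -/
def mBN : ℕ := mBX &&& mBY
/-- `{x~b} ∖ {y~b}`. [this work] -/
def mBpx : ℕ := mBX &&& (full ^^^ mBY)
/-- `{y~b} ∖ {x~b}`. [this work] -/
def mBpy : ℕ := mBY &&& (full ^^^ mBX)
/-- `{x~c} ∪ {y~c}`. [this work] -/
def mCU : ℕ := mCX ||| mCY
/-- `{x~c} ∩ {y~c}`. [this work] -/
def mCN : ℕ := mCX &&& mCY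
/-- `{x~c} ∖ {y~c}`. [this work] -/
def mCpx : ℕ := mCX &&& (full ^^^ mCY)
/-- `{y~c} ∖ {x~c}`. [this work] -/
def mCpy : ℕ := mCY &&& (full ^^^ mCX)
/-- `{x~b} ∩ {x~c}`. [this work] -/
def mMxx : ℕ := mBX &&& mCX
/-- `{y~b} ∩ {y~c}`. [this work] -/
def mMyy : ℕ := mBY &&& mCY
/-- `({x~b} ∪ {y~b}) ∩ ({x~c} ∪ {y~c})`. [this work] -/
def mMU : ℕ := (mBX ||| mBY) &&& (mCX ||| mCY)
/-- `{x~b} ∩ {y~b} ∩ {x~c} ∩ {y~c}`. [this work] -/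
def mMN : ℕ := (mBX &&& mBY) &&& (mCX &&& mCY)

/-! ### Structured sub-expressions (kernel side `…E`, value side `…Val`) -/

/-- `S_q = q0 + qX + qY + qW` (kernel expression). [this work] -/
def sqE : Expr :=
  .add (.add (.add (.var 15) (.var 16)) (.var 17)) (.var 18)
/-- `S_q = q0 + qX + qY + qW` (value). [this work] -/
noncomputable def sqVal (x : ℕ → ℝ) : ℝ :=
  ((x 15 + x 16) + x 17) + x 18

/-- `P_b = qX bx + qY by + qW bU` (bidegree (1,1)) (kernel expression). [this work] -/
def pbE : Expr :=
  .add (.add (.mul (.var 16) (maskE mBX)) (.mul (.var 17) (maskE mBY))) (.mul (.var 18) (maskE mBU))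
/-- `P_b = qX bx + qY by + qW bU` (bidegree (1,1)) (value). [this work] -/
noncomputable def pbVal (x : ℕ → ℝ) : ℝ :=
  ((x 16 * msum mBX x) + (x 17 * msum mBY x)) + (x 18 * msum mBU x)

/-- `P_c = qX cx + qY cy + qW cU` (kernel expression). [this work] -/
def pcE : Expr :=
  .add (.add (.mul (.var 16) (maskE mCX)) (.mul (.var 17) (maskE mCY))) (.mul (.var 18) (maskE mCU))
/-- `P_c = qX cx + qY cy + qW cU` (value). [this work] -/
noncomputable def pcVal (x : ℕ → ℝ) : ℝ :=
  ((x 16 * msum mCX x) + (x 17 * msum mCY x)) + (x 18 * msum mCU x)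

/-- `P_bc = qX mxx + qY myy + qW mU` (kernel expression). [this work] -/
def pbcE : Expr :=
  .add (.add (.mul (.var 16) (maskE mMxx)) (.mul (.var 17) (maskE mMyy))) (.mul (.var 18) (maskE mMU))
/-- `P_bc = qX mxx + qY myy + qW mU` (value). [this work] -/
noncomputable def pbcVal (x : ℕ → ℝ) : ℝ :=
  ((x 16 * msum mMxx x) + (x 17 * msum mMyy x)) + (x 18 * msum mMU x)

/-- `K = P_bc S_q S_f − P_b P_c` (bidegree (2,2)) (kernel expression). [this work] -/
def k22E : Expr :=
  .sub (.mul (.mul pbcE sqE) (maskE full)) (.mul pbE pcE)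
/-- `K = P_bc S_q S_f − P_b P_c` (bidegree (2,2)) (value). [this work] -/
noncomputable def k22Val (x : ℕ → ℝ) : ℝ :=
  ((pbcVal x * sqVal x) * msum full x) - (pbVal x * pcVal x)

/-- `Φ_X = 2 mxx S_q² S_f − bx P_c S_q − cx P_b S_q − K` (kernel expression). [this work] -/
def phiXE : Expr :=
  .sub (.sub (.sub (.mul (.mul (.mul (.mul (.natCast 2) (maskE mMxx)) sqE) sqE) (maskE full)) (.mul (.mul (maskE mBX) pcE) sqE)) (.mul (.mul (maskE
    mCX) pbE) sqE)) k22E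
/-- `Φ_X = 2 mxx S_q² S_f − bx P_c S_q − cx P_b S_q − K` (value). [this work] -/
noncomputable def phiXVal (x : ℕ → ℝ) : ℝ :=
  (((((((2 : ℝ) * msum mMxx x) * sqVal x) * sqVal x) * msum full x) - ((msum mBX x * pcVal x) * sqVal x)) - ((msum mCX x * pbVal x) * sqVal x)) -
    k22Val x

/-- `Φ_Y = 2 myy S_q² S_f − by P_c S_q − cy P_b S_q − K` (kernel expression). [this work] -/
def phiYE : Expr :=
  .sub (.sub (.sub (.mul (.mul (.mul (.mul (.natCast 2) (maskE mMyy)) sqE) sqE) (maskE full)) (.mul (.mul (maskE mBY) pcE) sqE)) (.mul (.mul (maskE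
    mCY) pbE) sqE)) k22E
/-- `Φ_Y = 2 myy S_q² S_f − by P_c S_q − cy P_b S_q − K` (value). [this work] -/
noncomputable def phiYVal (x : ℕ → ℝ) : ℝ :=
  (((((((2 : ℝ) * msum mMyy x) * sqVal x) * sqVal x) * msum full x) - ((msum mBY x * pcVal x) * sqVal x)) - ((msum mCY x * pbVal x) * sqVal x)) -
    k22Val x

/-- `Φ_XY = 2 mU S_q² S_f − bU P_c S_q − cU P_b S_q − K` (kernel expression). [this work] -/
def phiXYE : Expr :=
  .sub (.sub (.sub (.mul (.mul (.mul (.mul (.natCast 2) (maskE mMU)) sqE) sqE) (maskE full)) (.mul (.mul (maskE mBU) pcE) sqE)) (.mul (.mul (maskE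
    mCU) pbE) sqE)) k22E
/-- `Φ_XY = 2 mU S_q² S_f − bU P_c S_q − cU P_b S_q − K` (value). [this work] -/
noncomputable def phiXYVal (x : ℕ → ℝ) : ℝ :=
  (((((((2 : ℝ) * msum mMU x) * sqVal x) * sqVal x) * msum full x) - ((msum mBU x * pcVal x) * sqVal x)) - ((msum mCU x * pbVal x) * sqVal x)) -
    k22Val x

/-- `Φ_D = (2 mN S_q² S_f − bN P_c S_q − cN P_b S_q) S_f − ζ K` (bidegree (2,3)) (kernel expression). [this work] -/
def phiDE : Expr :=
  .sub (.mul (.sub (.sub (.mul (.mul (.mul (.mul (.natCast 2) (maskE mMN)) sqE) sqE) (maskE full)) (.mul (.mul (maskE mBN) pcE) sqE)) (.mul (.mul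
    (maskE mCN) pbE) sqE)) (maskE full)) (.mul (maskE mZ) k22E)
/-- `Φ_D = (2 mN S_q² S_f − bN P_c S_q − cN P_b S_q) S_f − ζ K` (bidegree (2,3)) (value). [this work] -/
noncomputable def phiDVal (x : ℕ → ℝ) : ℝ :=
  ((((((((2 : ℝ) * msum mMN x) * sqVal x) * sqVal x) * msum full x) - ((msum mBN x * pcVal x) * sqVal x)) - ((msum mCN x * pbVal x) * sqVal x)) * msum
    full x) - (msum mZ x * k22Val x)

/-- `2 qW S_q − (qX+qW)(qY+qW)` (= `2w − x̄ȳ`, bidegree (2,0)) (kernel expression). [this work] -/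
def twoWE : Expr :=
  .sub (.mul (.mul (.natCast 2) (.var 18)) sqE) (.mul (.add (.var 16) (.var 18)) (.add (.var 17) (.var 18)))
/-- `2 qW S_q − (qX+qW)(qY+qW)` (= `2w − x̄ȳ`, bidegree (2,0)) (value). [this work] -/
noncomputable def twoWVal (x : ℕ → ℝ) : ℝ :=
  (((2 : ℝ) * x 18) * sqVal x) - ((x 16 + x 18) * (x 17 + x 18))

/-- `π_xy = bpx cpy + bpy cpx` (bidegree (0,2)) (kernel expression). [this work] -/
def pixyE : Expr :=
  .add (.mul (maskE mBpx) (maskE mCpy)) (.mul (maskE mBpy) (maskE mCpx))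
/-- `π_xy = bpx cpy + bpy cpx` (bidegree (0,2)) (value). [this work] -/
noncomputable def pixyVal (x : ℕ → ℝ) : ℝ :=
  (msum mBpx x * msum mCpy x) + (msum mBpy x * msum mCpx x)

/-- **the (FX) form** `qX Φ_X S_f + qW Φ_XY S_f + qY Φ_D − (q0+qY)·(2w−x̄ȳ)·π_xy·S_f` (bidegree (3,3)) (kernel expression). [this work] -/
def fxFormE : Expr :=
  .sub (.add (.add (.mul (.mul (.var 16) phiXE) (maskE full)) (.mul (.mul (.var 18) phiXYE) (maskE full))) (.mul (.var 17) phiDE)) (.mul (.mul (.mul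
    (.add (.var 15) (.var 17)) twoWE) pixyE) (maskE full))
/-- **the (FX) form** `qX Φ_X S_f + qW Φ_XY S_f + qY Φ_D − (q0+qY)·(2w−x̄ȳ)·π_xy·S_f` (bidegree (3,3)) (value). [this work] -/
noncomputable def fxFormVal (x : ℕ → ℝ) : ℝ :=
  ((((x 16 * phiXVal x) * msum full x) + ((x 18 * phiXYVal x) * msum full x)) + (x 17 * phiDVal x)) - ((((x 15 + x 17) * twoWVal x) * pixyVal x) *
    msum full x)

/-- **the (FY) form** `qY Φ_Y S_f + qW Φ_XY S_f + qX Φ_D − (q0+qX)·(2w−x̄ȳ)·π_xy·S_f` (kernel expression). [this work] -/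
def fyFormE : Expr :=
  .sub (.add (.add (.mul (.mul (.var 17) phiYE) (maskE full)) (.mul (.mul (.var 18) phiXYE) (maskE full))) (.mul (.var 16) phiDE)) (.mul (.mul (.mul
    (.add (.var 15) (.var 16)) twoWE) pixyE) (maskE full))
/-- **the (FY) form** `qY Φ_Y S_f + qW Φ_XY S_f + qX Φ_D − (q0+qX)·(2w−x̄ȳ)·π_xy·S_f` (value). [this work] -/
noncomputable def fyFormVal (x : ℕ → ℝ) : ℝ :=
  ((((x 17 * phiYVal x) * msum full x) + ((x 18 * phiXYVal x) * msum full x)) + (x 16 * phiDVal x)) - ((((x 15 + x 16) * twoWVal x) * pixyVal x) *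
    msum full x)

/-! ### What the forms denote -/

variable (x : ℕ → ℝ)

/-- `sqE` denotes `sqVal`. [this work] -/
theorem denote_sqE : sqE.denote (ctx19 x) = sqVal x := by
  simp only [sqE, sqVal, denote_add, denote_var19 x (show 15 < 19 by norm_num), denote_var19 x (show 16 < 19 by norm_num), denote_var19 x (show 17 < 19 by norm_num), denote_var19 x (show 18 < 19 by norm_num)]

/-- `pbE` denotes `pbVal`. [this work] -/
theorem denote_pbE : pbE.denote (ctx19 x) = pbVal x := by
  simp only [pbE, pbVal, denote_add, denote_mul, denote_maskE19, denote_var19 x (show 16 < 19 by norm_num), denote_var19 x (show 17 < 19 by norm_num), denote_var19 x (show 18 < 19 by norm_num)]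

/-- `pcE` denotes `pcVal`. [this work] -/
theorem denote_pcE : pcE.denote (ctx19 x) = pcVal x := by
  simp only [pcE, pcVal, denote_add, denote_mul, denote_maskE19, denote_var19 x (show 16 < 19 by norm_num), denote_var19 x (show 17 < 19 by norm_num), denote_var19 x (show 18 < 19 by norm_num)]

/-- `pbcE` denotes `pbcVal`. [this work] -/
theorem denote_pbcE : pbcE.denote (ctx19 x) = pbcVal x := by
  simp only [pbcE, pbcVal, denote_add, denote_mul, denote_maskE19, denote_var19 x (show 16 < 19 by norm_num), denote_var19 x (show 17 < 19 by norm_num), denote_var19 x (show 18 < 19 by norm_num)]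

/-- `k22E` denotes `k22Val`. [this work] -/
theorem denote_k22E : k22E.denote (ctx19 x) = k22Val x := by
  simp only [k22E, k22Val, denote_pbcE, denote_sqE, denote_pbE, denote_pcE, denote_sub, denote_mul, denote_maskE19]

/-- `phiXE` denotes `phiXVal`. [this work] -/
theorem denote_phiXE : phiXE.denote (ctx19 x) = phiXVal x := by
  simp only [phiXE, phiXVal, denote_sqE, denote_pcE, denote_pbE, denote_k22E, denote_sub, denote_mul, denote_natCast, Nat.cast_ofNat, denote_maskE19]

/-- `phiYE` denotes `phiYVal`. [this work] -/
theorem denote_phiYE : phiYE.denote (ctx19 x) = phiYVal x := by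
  simp only [phiYE, phiYVal, denote_sqE, denote_pcE, denote_pbE, denote_k22E, denote_sub, denote_mul, denote_natCast, Nat.cast_ofNat, denote_maskE19]

/-- `phiXYE` denotes `phiXYVal`. [this work] -/
theorem denote_phiXYE : phiXYE.denote (ctx19 x) = phiXYVal x := by
  simp only [phiXYE, phiXYVal, denote_sqE, denote_pcE, denote_pbE, denote_k22E, denote_sub, denote_mul, denote_natCast, Nat.cast_ofNat, denote_maskE19]

/-- `phiDE` denotes `phiDVal`. [this work] -/
theorem denote_phiDE : phiDE.denote (ctx19 x) = phiDVal x := by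
  simp only [phiDE, phiDVal, denote_sqE, denote_pcE, denote_pbE, denote_k22E, denote_sub, denote_mul, denote_natCast, Nat.cast_ofNat, denote_maskE19]

/-- `twoWE` denotes `twoWVal`. [this work] -/
theorem denote_twoWE : twoWE.denote (ctx19 x) = twoWVal x := by
  simp only [twoWE, twoWVal, denote_sqE, denote_add, denote_sub, denote_mul, denote_natCast, Nat.cast_ofNat, denote_var19 x (show 16 < 19 by norm_num), denote_var19 x (show 17 < 19 by norm_num), denote_var19 x (show 18 < 19 by norm_num)]

/-- `pixyE` denotes `pixyVal`. [this work] -/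
theorem denote_pixyE : pixyE.denote (ctx19 x) = pixyVal x := by
  simp only [pixyE, pixyVal, denote_add, denote_mul, denote_maskE19]

/-- `fxFormE` denotes `fxFormVal`. [this work] -/
theorem denote_fxFormE : fxFormE.denote (ctx19 x) = fxFormVal x := by
  simp only [fxFormE, fxFormVal, denote_phiXE, denote_phiXYE, denote_phiDE, denote_twoWE, denote_pixyE, denote_add, denote_sub, denote_mul, denote_maskE19, denote_var19 x (show 15 < 19 by norm_num), denote_var19 x (show 16 < 19 by norm_num), denote_var19 x (show 17 < 19 by norm_num), denote_var19 x (show 18 < 19 by norm_num)]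

/-- `fyFormE` denotes `fyFormVal`. [this work] -/
theorem denote_fyFormE : fyFormE.denote (ctx19 x) = fyFormVal x := by
  simp only [fyFormE, fyFormVal, denote_phiYE, denote_phiXYE, denote_phiDE, denote_twoWE, denote_pixyE, denote_add, denote_sub, denote_mul, denote_maskE19, denote_var19 x (show 15 < 19 by norm_num), denote_var19 x (show 16 < 19 by norm_num), denote_var19 x (show 17 < 19 by norm_num), denote_var19 x (show 18 < 19 by norm_num)]

end IncStarTwoCut.FXCert

end Summit.CriticalPhenomena.PercolationContinuityZ3.Theorems
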